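import Literature.InformationTheory.QuantumCodes.TwoBlockGroupAlgebraCodes
import Literature.LinearAlgebra.Matrix.RankInequalities
import Mathlib.LinearAlgebra.Projection
import Mathlib.LinearAlgebra.Matrix.ToLin
import HarnessLib

/-!
# The dimension of a two-block CSS code over a field: rank defects (Lin–Pryadko 2024, §III.A),
# proved in corrected form, with Statements 1–2 and two kernel counterexamples to the printed text

Source followed: H.-K. Lin, L. P. Pryadko, *Quantum two-block group algebra codes*, Phys. Rev. A
**109** (2024) 022407 = arXiv:2306.16400 [LinPryadko2024], §III "Two-block CSS codes" and §III.A
"Code dimension" (held text `paper:arxiv-2306.16400`, chunk p0006), App. A proofs of Statements 1–2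
(chunk p0016 L1–35), and §IV.E (chunk p0011 L1–35: GB codes, abelian 2BGA codes, Statement 9).

## The printed theory (p0006)

For square commuting `A, B ∈ M_ℓ(F)` over a field `F` the two-block code has `H_X = (A, B)`,
`H_Zᵀ = (B; −A)`; `css(A, Bᵀ)` is the single-block subsystem erasure code with parameters
`[[ℓ, k_S, d_S]]` and `p⋆ ≡ rank(AB)` gauge qudits, so that by the subsystem dimension formula
`k = n − rank G_X − rank G_Z + rank(G_X G_Zᵀ)` (§II.B, p0005 L97–99) `k_S = ℓ − rank A − rank B + rank(AB)`.
With idempotents `E_A² = E_A`, `F_A² = F_A` "of the same rank as `A`, such that `E_A A = A F_A = A`"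
the text asserts (RX) `rank H_X = rank A + rank (I − E_A)B = rank A + rank B − rank(E_A B)`,
(RZ) `rank H_Z = rank A + rank B − rank(B F_A)`, defines the *rank defects* `rank E_A B ≡ p⋆ + δ_X`,
`rank B F_A ≡ p⋆ + δ_Z`, states that they are "independent of the choice of idempotents",
and concludes `rank H_X = ℓ − k_S − δ_X`, `rank H_Z = ℓ − k_S − δ_Z` and
**`k = 2k_S + δ_X + δ_Z`**; Statement 1: "If `E_A` commutes with `B`, then `δ_X = 0`.
Similarly, if `F_A` commutes with `B`, then `δ_Z = 0`"; Statement 2: if an invertible `S` has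
`SAS⁻¹ = Aᵀ`, `SBS⁻¹ = Bᵀ` then `δ_X = δ_Z`. §IV.E (p0011 L11–14): for GB codes "`deg h(x)` also
coincides with the dimension `k_S` … for any cyclic group `G`, `δ_X = δ_Z = 0`"; Statement 9 (p0011
L26–35): "`N ≡ G_a ∩ G_b` abelian and normal in both support groups ⇒ `δ_X = δ_Z = 0`. In particular,
`δ_X = δ_Z = 0` for any abelian 2BGA code."

## What is PROVED here (every declaration is a theorem; no named facts)

Write `col M` for the column space `range(M)` of a square matrix.
* `TwoBlock.HX A B = (A, B)`, `TwoBlock.HZ A B = (Bᵀ, −Aᵀ)` over any field, `HX * HZᵀ = AB − BA`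
  (so commuting blocks give a CSS pair); agreement with the tree's `AbelianTwoBlock.HX/HZ` and
  `TwoBlockGA.HX/HZ` over `𝔽₂`.
* The first equality of (RX) and of (RZ) AS PRINTED, for EVERY admissible choice:
  `rank H_X = rank A + rank((1 − E_A)B)`, `rank H_Z = rank A + rank(B(1 − F_A))`
  (`rank_HX_eq_of_isLeftIdem`, `rank_HZ_eq_of_isRightIdem`); admissible idempotents exist
  (`exists_isLeftIdem`, `exists_isRightIdem`).
* The INTRINSIC form of (RX), (RZ) and the dimension formula: `rank H_X = rank A + rank B − dim(col A ∩ col B)`,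
  `rank H_Z = rank A + rank B − dim(row A ∩ row B)` (`rank_HX_add_finrank_inf`,
  `rank_HZ_add_finrank_inf`); with `δ_X := dim(col A ∩ col B) − rank(AB) ≥ 0`,
  `δ_Z := dim(row A ∩ row B) − rank(AB) ≥ 0` (`col(AB) ⊆ col A ∩ col B` for commuting `A, B`) and
  `k_S := ℓ − rank A − rank B + rank(AB)` (an honest difference by Sylvester's inequality,
  `rank_add_rank_le`): `rank H_X = ℓ − k_S − δ_X`, `rank H_Z = ℓ − k_S − δ_Z`, and
  **`k = 2ℓ − rank H_X − rank H_Z = 2k_S + δ_X + δ_Z`** (`dim_eq`), in particular for the tree's CSS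
  codes `AbelianTwoBlock.css a b` and `TwoBlockGA.css a b` over `𝔽₂` (`css_k_eq_abelian`,
  `css_k_eq_ga`).
* The printed choice-dependent quantity `rank(E_A B)` always satisfies
  `rank(AB) ≤ dim(col A ∩ col B) ≤ rank(E_A B)` (`rank_mul_le_finrank_inf`,
  `finrank_inf_le_rank_idem_mul`): the intrinsic defect is the least printed defect, and the second
  equality of (RX) holds as the inequality `rank A + rank B ≤ rank H_X + rank(E_A B)`
  (`rank_add_rank_le_rank_HX_add`), with equality iff `rank(E_A B) = dim(col A ∩ col B)`.
* **Statement 1** (as printed, for the chosen idempotent, and hence intrinsically):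
  `E_A B = B E_A ⇒ rank(E_A B) = rank(AB) = dim(col A ∩ col B)`, `δ_X = 0`,
  `rank H_X = rank A + rank B − rank(AB)`; the `F_A`/`δ_Z` clause likewise.
* **Statement 2** (intrinsic form): `SAS⁻¹ = Aᵀ`, `SBS⁻¹ = Bᵀ` ⇒ `δ_X = δ_Z` and
  `rank H_X = rank H_Z`.

## What FAILS as printed (kernel counterexamples over `𝔽₂`, `ℓ = 2`)

* `printed_defect_depends_on_choice`: `A = diag(1,0)`, `B = diag(0,1)` (commuting), and the two
  admissible idempotents `E = [[1,1],[0,0]]`, `E' = diag(1,0)` for `A` give `rank(E B) = 1 ≠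
  rank(E' B) = 0` while `rank(AB) = 0`: the printed `δ_X` is NOT independent of the choice
  (contrary to p0006 L94–98), the printed step "`rank B = rank(E_A B) + rank (I−E_A)B`" (p0006 L70–71)
  fails (`1 ≠ 1 + 1`), and so do the second equality of (RX) and `k = 2k_S + δ_X + δ_Z` for the choice `E`
  (`rank H_X = 2 ≠ rank A + rank B − rank(E B) = 1`; `k = 0`, `k_S = 0`).
* `fourTwoTwo_defects`: the cyclic (abelian) 2BGA / GB code `LP[1+x, 1+x]` over `𝔽₂[ℤ₂]` — the
  `[[4,2,2]]` code, `A = B = circulant(1+x) =` the all-ones `2 × 2` matrix `J`, `J² = 0` — has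
  `k = 2`, `k_S = 0`, `rank(AB) = 0` and `δ_X = δ_Z = 1` intrinsically AND `rank(E_A B) = 1` for
  EVERY admissible `E_A` (as `E_A J = J`): so "for any cyclic group `G`, `δ_X = δ_Z = 0`"
  (§IV.E, p0011 L11–14; here `deg h = deg(1+x) = 1 ≠ k_S = 0`) and Statement 9's "`δ_X = δ_Z = 0` for any
  abelian 2BGA code" (p0011 L33–35; here `N = G_a = G_b = ℤ₂`) fail when `char F` divides `|G|`
  (the group algebra `𝔽₂[ℤ₂]` is not semisimple; the text's semisimple route, Statement 10, goes through
  Statement 1, proved here; the GB dimension formula `k = 2 deg gcd(a, b, x^ℓ − 1)` — the tree's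
  `PanteleevKalachev2021_prop1_holds` — is untouched).

Scope: §III.A only (dimension). The distance statements of §III.B–C (Statements 3–5 and the `d_Z`
identities) use
`E_A`, `F_A`, `δ_X`, `δ_Z` as well and are NOT typed here. The shorter conference version
R. Wang, H.-K. Lin, L. P. Pryadko, ISTC 2023 = arXiv:2305.06890 [WangLinPryadko2023] §III prints only
the first equalities of (RX)/(RZ) and Statement 1 with both `E_A`, `F_A` commuting (held text chunk
p0005 L17–67) — all proved below. Equation numbers of the journal version are not quoted (the held
text is the arXiv TeX; displayed formulas are located by their TeX labels and chunk lines).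
-/

namespace Literature.InformationTheory.QuantumCodes

namespace TwoBlock

open Matrix Module

/-! ### Linear-algebra preliminaries (column spaces of square matrices over a field) -/

section Prelim

variable {F : Type*} [Field F] {ι : Type*} [Fintype ι]

/-- The column space `col M = range(v ↦ M v)` of a matrix. [folklore] -/
abbrev col {κ : Type*} [Fintype κ] (M : Matrix ι κ F) : Submodule F (ι → F) :=
  LinearMap.range M.mulVecLin

omit [Fintype ι] in
/-- `rank M = dim col M` (Mathlib's definition of `Matrix.rank`). [folklore] -/
private theorem rank_eq_finrank_col {κ : Type*} [Fintype κ] (M : Matrix ι κ F) :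
    M.rank = finrank F ↥(col M) := rfl

/-- `col(M N) ≤ col M`. [folklore] -/
private theorem col_mul_le_left (M N : Matrix ι ι F) : col (M * N) ≤ col M := by
  rintro _ ⟨v, rfl⟩
  exact ⟨N *ᵥ v, by simp [Matrix.mulVec_mulVec]⟩

/-- `col(M N) = M(col N)`. [folklore] -/
private theorem col_mul_eq_map (M N : Matrix ι ι F) : col (M * N) = (col N).map M.mulVecLin := by
  rw [col, Matrix.mulVecLin_mul, LinearMap.range_comp]

/-- `col [A | B] = col A ⊔ col B`. [folklore] -/
private theorem col_fromCols (A B : Matrix ι ι F) : col (fromCols A B) = col A ⊔ col B := by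
  apply le_antisymm
  · rintro _ ⟨v, rfl⟩
    rw [Matrix.mulVecLin_apply, Matrix.fromCols_mulVec]
    exact Submodule.add_mem_sup (LinearMap.mem_range_self A.mulVecLin _)
      (LinearMap.mem_range_self B.mulVecLin _)
  · refine sup_le ?_ ?_
    · rintro _ ⟨v, rfl⟩
      refine ⟨Sum.elim v 0, ?_⟩
      rw [Matrix.mulVecLin_apply, Matrix.mulVecLin_apply, Matrix.fromCols_mulVec_sumElim,
        mulVec_zero, add_zero]
    · rintro _ ⟨v, rfl⟩
      refine ⟨Sum.elim 0 v, ?_⟩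
      rw [Matrix.mulVecLin_apply, Matrix.mulVecLin_apply, Matrix.fromCols_mulVec_sumElim,
        mulVec_zero, zero_add]

/-- `rank [A | B] + dim(col A ∩ col B) = rank A + rank B`. [folklore] -/
private theorem rank_fromCols_add_finrank_inf (A B : Matrix ι ι F) :
    (fromCols A B).rank + finrank F ↥(col A ⊓ col B) = A.rank + B.rank := by
  rw [rank_eq_finrank_col, col_fromCols]
  exact Submodule.finrank_sup_add_finrank_inf_eq _ _

/-- `col (-M) = col M`. [folklore] -/
private theorem col_neg (M : Matrix ι ι F) : col (-M) = col M := by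
  have : (-M).mulVecLin = -M.mulVecLin := by
    apply LinearMap.ext; intro v; simp
  rw [col, this, LinearMap.range_neg]

/-- `rank (-M) = rank M`. [folklore] -/
private theorem rank_neg' (M : Matrix ι ι F) : (-M).rank = M.rank := by
  rw [rank_eq_finrank_col, rank_eq_finrank_col, col_neg]

/-- Sylvester's rank inequality `rank A + rank B ≤ ℓ + rank(AB)` (the tree's
`Literature.LinearAlgebra.Matrix.rank_add_rank_le_rank_mul_add_card`, Horn–Johnson 0.4.5 (c)).
[cite: HornJohnson2013, §0.4.5 (c), p. 13] -/
theorem rank_add_rank_le (A B : Matrix ι ι F) :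
    A.rank + B.rank ≤ Fintype.card ι + (A * B).rank := by
  have := Literature.LinearAlgebra.Matrix.rank_add_rank_le_rank_mul_add_card A B
  omega

/-- An idempotent matrix fixes its column space pointwise. [folklore] -/
private theorem mulVec_eq_self_of_mem_col {E : Matrix ι ι F} (hE : E * E = E) {v : ι → F} (hv : v ∈ col E) :
    E *ᵥ v = v := by
  obtain ⟨w, rfl⟩ := hv
  rw [Matrix.mulVecLin_apply, Matrix.mulVec_mulVec, hE]

/-- For an idempotent `E`: `col E ⊓ ker E = ⊥`. [folklore] -/
private theorem col_inf_ker_eq_bot {E : Matrix ι ι F} (hE : E * E = E) :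
    col E ⊓ LinearMap.ker E.mulVecLin = ⊥ := by
  rw [Submodule.eq_bot_iff]
  rintro v ⟨hv, hv'⟩
  rw [SetLike.mem_coe, LinearMap.mem_ker, Matrix.mulVecLin_apply, mulVec_eq_self_of_mem_col hE hv]
    at hv'
  exact hv'

variable [DecidableEq ι]

/-- For an idempotent `E`: `col(1 − E) = ker E`. [folklore] -/
private theorem col_one_sub_eq_ker {E : Matrix ι ι F} (hE : E * E = E) :
    col (1 - E) = LinearMap.ker E.mulVecLin := by
  apply le_antisymm
  · rintro _ ⟨v, rfl⟩
    rw [LinearMap.mem_ker, Matrix.mulVecLin_apply, Matrix.mulVecLin_apply, Matrix.mulVec_mulVec,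
      Matrix.mul_sub, Matrix.mul_one, hE, sub_self, Matrix.zero_mulVec]
  · intro v hv
    rw [LinearMap.mem_ker, Matrix.mulVecLin_apply] at hv
    exact ⟨v, by rw [Matrix.mulVecLin_apply, Matrix.sub_mulVec, Matrix.one_mulVec, hv, sub_zero]⟩

end Prelim

/-! ### The two-block matrices over a field -/

section Defs

variable {F : Type*} [Field F] {ι : Type*}

/-- `H_X = (A, B)`. [cite: LinPryadko2024, §III displayed `H_X = (A,B), H_Zᵀ = (B; −A)` (tex label eq:css-blocks; arXiv:2306.16400 chunk p0006 L6–10)] -/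
def HX (A B : Matrix ι ι F) : Matrix ι (ι ⊕ ι) F := fromCols A B

/-- `H_Z` with `H_Zᵀ = (B; −A)`, i.e. `H_Z = (Bᵀ, −Aᵀ)`.
[cite: LinPryadko2024, §III displayed `H_X = (A,B), H_Zᵀ = (B; −A)` (tex label eq:css-blocks; arXiv:2306.16400 chunk p0006 L6–10)] -/
def HZ (A B : Matrix ι ι F) : Matrix ι (ι ⊕ ι) F := fromCols Bᵀ (-Aᵀ)

omit [Field F] in
/-- Unfolding lemma. [cite: LinPryadko2024, §III displayed `H_X = (A,B), H_Zᵀ = (B; −A)` (tex label eq:css-blocks; arXiv:2306.16400 chunk p0006 L6–10)] -/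
theorem HX_def (A B : Matrix ι ι F) : HX A B = fromCols A B := rfl

/-- Unfolding lemma. [cite: LinPryadko2024, §III displayed `H_X = (A,B), H_Zᵀ = (B; −A)` (tex label eq:css-blocks; arXiv:2306.16400 chunk p0006 L6–10)] -/
theorem HZ_def (A B : Matrix ι ι F) : HZ A B = fromCols Bᵀ (-Aᵀ) := rfl

variable [Fintype ι]

/-- `H_X H_Zᵀ = AB − BA`. [cite: LinPryadko2024, §III "The commutativity is important, since it guarantees the CSS orthogonality condition" (arXiv:2306.16400 chunk p0006 L11–14)] -/
theorem HX_mul_HZ_transpose (A B : Matrix ι ι F) : HX A B * (HZ A B)ᵀ = A * B - B * A := by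
  rw [HX, HZ, transpose_fromCols, transpose_transpose, transpose_neg, transpose_transpose,
    fromCols_mul_fromRows, Matrix.mul_neg, sub_eq_add_neg]

/-- Commuting blocks give the CSS orthogonality `H_X H_Zᵀ = 0`. [cite: LinPryadko2024, §III (arXiv:2306.16400 chunk p0006 L11–14)] -/
theorem HX_mul_HZ_transpose_eq_zero {A B : Matrix ι ι F} (hAB : A * B = B * A) :
    HX A B * (HZ A B)ᵀ = 0 := by
  rw [HX_mul_HZ_transpose, hAB, sub_self]

omit [Field F] [Fintype ι] in
/-- For a finite abelian group, `TwoBlock.HX (circulant a) (circulant b)` is the tree's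
`AbelianTwoBlock.HX a b`. [cite: LinPryadko2024, §IV.A matrices `L(a)`, `R(b)` (arXiv:2306.16400 chunk p0009 L17–19)] -/
theorem HX_circulant {G : Type*} [AddCommGroup G] (a b : G → F) :
    HX (circulant a) (circulant b) = AbelianTwoBlock.HX a b := rfl

/-- Over `𝔽₂`, `TwoBlock.HZ (circulant a) (circulant b) = AbelianTwoBlock.HZ a b` (the sign is
invisible in characteristic two). [cite: LinPryadko2024, §IV.A matrices `L(a)`, `R(b)` (arXiv:2306.16400 chunk p0009 L17–19)] -/
theorem HZ_circulant {G : Type*} [AddCommGroup G] (a b : G → ZMod 2) :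
    HZ (circulant a) (circulant b) = AbelianTwoBlock.HZ a b := by
  rw [HZ, AbelianTwoBlock.HZ_def]
  congr 1
  ext i j
  exact ZMod.neg_eq_self_mod_two _

omit [Field F] [Fintype ι] in
/-- For an arbitrary group, `TwoBlock.HX (L(a)) (R(b)) = TwoBlockGA.HX a b`.
[cite: LinPryadko2024, §IV.A matrices `L(a)`, `R(b)` (arXiv:2306.16400 chunk p0009 L17–19)] -/
theorem HX_leftMul_rightMul {G : Type*} [Group G] (a b : G → F) :
    HX (TwoBlockGA.leftMul a) (TwoBlockGA.rightMul b) = TwoBlockGA.HX a b := rfl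

/-- Over `𝔽₂`, `TwoBlock.HZ (L(a)) (R(b)) = TwoBlockGA.HZ a b`.
[cite: LinPryadko2024, §IV.A matrices `L(a)`, `R(b)` (arXiv:2306.16400 chunk p0009 L17–19)] -/
theorem HZ_leftMul_rightMul {G : Type*} [Group G] (a b : G → ZMod 2) :
    HZ (TwoBlockGA.leftMul a) (TwoBlockGA.rightMul b) = TwoBlockGA.HZ a b := by
  rw [HZ, TwoBlockGA.HZ]
  congr 1
  ext i j
  exact ZMod.neg_eq_self_mod_two _

end Defs

/-! ### The intrinsic rank formulas and the dimension identity (corrected form) -/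

section Intrinsic

variable {F : Type*} [Field F] {ι : Type*} [Fintype ι]

/-- (RX), intrinsic form: `rank H_X + dim(col A ∩ col B) = rank A + rank B`.
[cite: LinPryadko2024, §III.A formula `rank H_X = rank A + rank B − rank(E_A B)` (tex label eq:rankHx; arXiv:2306.16400 chunk p0006 L60–66), corrected: `rank(E_A B)` replaced by `dim(col A ∩ col B)`] -/
theorem rank_HX_add_finrank_inf (A B : Matrix ι ι F) :
    (HX A B).rank + finrank F ↥(col A ⊓ col B) = A.rank + B.rank :=
  rank_fromCols_add_finrank_inf A B

/-- (RZ), intrinsic form: `rank H_Z + dim(row A ∩ row B) = rank A + rank B` (`row M = col Mᵀ`).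
[cite: LinPryadko2024, §III.A formula `rank H_Z = rank A + rank B − rank(B F_A)` (tex label eq:rankHz; arXiv:2306.16400 chunk p0006 L72–77), corrected: `rank(B F_A)` replaced by `dim(row A ∩ row B)`] -/
theorem rank_HZ_add_finrank_inf (A B : Matrix ι ι F) :
    (HZ A B).rank + finrank F ↥(col Aᵀ ⊓ col Bᵀ) = A.rank + B.rank := by
  have h := rank_fromCols_add_finrank_inf Bᵀ (-Aᵀ)
  rw [col_neg, rank_neg', Matrix.rank_transpose, Matrix.rank_transpose, inf_comm] at h
  rw [HZ, h, add_comm]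

/-- `col(AB) ≤ col A ∩ col B` for commuting `A, B`. [cite: LinPryadko2024, §III.A "rank E_A B ≥ rank E_A B A = rank AB = p⋆" (arXiv:2306.16400 chunk p0006 L81)] -/
theorem col_mul_le_inf {A B : Matrix ι ι F} (hAB : A * B = B * A) : col (A * B) ≤ col A ⊓ col B :=
  le_inf (col_mul_le_left A B) (hAB ▸ col_mul_le_left B A)

/-- `p⋆ = rank(AB) ≤ dim(col A ∩ col B)` (non-negativity of the intrinsic `δ_X`).
[cite: LinPryadko2024, §III.A "non-negative rank defect parameters δ_X ≥ 0 and δ_Z ≥ 0" (tex label eq:rank-defect; arXiv:2306.16400 chunk p0006 L81–89)] -/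
theorem rank_mul_le_finrank_inf {A B : Matrix ι ι F} (hAB : A * B = B * A) :
    (A * B).rank ≤ finrank F ↥(col A ⊓ col B) :=
  Submodule.finrank_mono (col_mul_le_inf hAB)

/-- `rank(AB) ≤ dim(row A ∩ row B)` (non-negativity of the intrinsic `δ_Z`).
[cite: LinPryadko2024, §III.A "non-negative rank defect parameters δ_X ≥ 0 and δ_Z ≥ 0" (tex label eq:rank-defect; arXiv:2306.16400 chunk p0006 L81–89)] -/
theorem rank_mul_le_finrank_inf_transpose {A B : Matrix ι ι F} (hAB : A * B = B * A) :
    (A * B).rank ≤ finrank F ↥(col Aᵀ ⊓ col Bᵀ) := by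
  have h : Aᵀ * Bᵀ = Bᵀ * Aᵀ := by
    rw [← Matrix.transpose_mul, ← Matrix.transpose_mul, hAB]
  have := rank_mul_le_finrank_inf h
  rwa [← Matrix.transpose_mul, Matrix.rank_transpose, ← hAB] at this

/-- `p⋆ ≡ rank(AB)`, "the number of gauge qudits in the subsystem code `css(A, Bᵀ)`".
[cite: LinPryadko2024, §III `[[ℓ, k_S, d_S]]_q and p⋆ ≡ rank(AB)` (tex label eq:subsystem-AB; arXiv:2306.16400 chunk p0006 L16–26)] -/
noncomputable def pStar (A B : Matrix ι ι F) : ℕ := (A * B).rank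

/-- `k_S`, the dimension of the single-block subsystem erasure code `css(A, Bᵀ)`:
`k_S = ℓ − rank A − rank Bᵀ + rank(A (Bᵀ)ᵀ) = ℓ − rank A − rank B + rank(AB)` by the printed
subsystem dimension formula `k = n − rank G_X − rank G_Z + rank(G_X G_Zᵀ)` (an honest difference by
Sylvester's inequality, `kS_add`). [cite: LinPryadko2024, §II.B `k = n − rank G_X − rank G_Z + rank(G_X G_Zᵀ)` (tex label eq:subsystem-k; arXiv:2306.16400 chunk p0005 L97–99) and §III (tex label eq:subsystem-AB; chunk p0006 L16–26)] -/
noncomputable def kS (A B : Matrix ι ι F) : ℕ := Fintype.card ι + (A * B).rank - A.rank - B.rank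

/-- `k_S + rank A + rank B = ℓ + rank(AB)`. [cite: LinPryadko2024, §III (tex label eq:subsystem-AB) with §II.B (tex label eq:subsystem-k) (arXiv:2306.16400 chunks p0005 L97–99, p0006 L16–26)] -/
theorem kS_add (A B : Matrix ι ι F) :
    kS A B + A.rank + B.rank = Fintype.card ι + (A * B).rank := by
  have := rank_add_rank_le A B
  unfold kS
  omega

/-- The (intrinsic, choice-free) rank defect `δ_X := dim(col A ∩ col B) − rank(AB)`.
[cite: LinPryadko2024, §III.A `rank E_A B ≡ p⋆ + δ_X, rank B F_A ≡ p⋆ + δ_Z` (tex label eq:rank-defect; arXiv:2306.16400 chunk p0006 L84–89), corrected definition] -/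
noncomputable def defectX (A B : Matrix ι ι F) : ℕ := finrank F ↥(col A ⊓ col B) - (A * B).rank

/-- The (intrinsic) rank defect `δ_Z := dim(row A ∩ row B) − rank(AB)`.
[cite: LinPryadko2024, §III.A `rank E_A B ≡ p⋆ + δ_X, rank B F_A ≡ p⋆ + δ_Z` (tex label eq:rank-defect; arXiv:2306.16400 chunk p0006 L84–89), corrected definition] -/
noncomputable def defectZ (A B : Matrix ι ι F) : ℕ := finrank F ↥(col Aᵀ ⊓ col Bᵀ) - (A * B).rank

/-- `δ_X + p⋆ = dim(col A ∩ col B)`. [cite: LinPryadko2024, §III.A (tex label eq:rank-defect; arXiv:2306.16400 chunk p0006 L84–89)] -/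
theorem defectX_add {A B : Matrix ι ι F} (hAB : A * B = B * A) :
    defectX A B + (A * B).rank = finrank F ↥(col A ⊓ col B) := by
  have := rank_mul_le_finrank_inf hAB
  unfold defectX
  omega

/-- `δ_Z + p⋆ = dim(row A ∩ row B)`. [cite: LinPryadko2024, §III.A (tex label eq:rank-defect; arXiv:2306.16400 chunk p0006 L84–89)] -/
theorem defectZ_add {A B : Matrix ι ι F} (hAB : A * B = B * A) :
    defectZ A B + (A * B).rank = finrank F ↥(col Aᵀ ⊓ col Bᵀ) := by
  have := rank_mul_le_finrank_inf_transpose hAB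
  unfold defectZ
  omega

/-- `rank H_X = ℓ − k_S − δ_X`, additively. [cite: LinPryadko2024, §III.A `rank H_X = ℓ − k_S − δ_X, rank H_Z = ℓ − k_S − δ_Z` (arXiv:2306.16400 chunk p0006 L117–120)] -/
theorem rank_HX_add_kS_add_defectX {A B : Matrix ι ι F} (hAB : A * B = B * A) :
    (HX A B).rank + kS A B + defectX A B = Fintype.card ι := by
  have h1 := rank_HX_add_finrank_inf A B
  have h2 := kS_add A B
  have h3 := defectX_add hAB
  omega

/-- `rank H_Z = ℓ − k_S − δ_Z`, additively. [cite: LinPryadko2024, §III.A `rank H_X = ℓ − k_S − δ_X, rank H_Z = ℓ − k_S − δ_Z` (arXiv:2306.16400 chunk p0006 L117–120)] -/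
theorem rank_HZ_add_kS_add_defectZ {A B : Matrix ι ι F} (hAB : A * B = B * A) :
    (HZ A B).rank + kS A B + defectZ A B = Fintype.card ι := by
  have h1 := rank_HZ_add_finrank_inf A B
  have h2 := kS_add A B
  have h3 := defectZ_add hAB
  omega

/-- `rank H_X + rank H_Z ≤ 2ℓ` for commuting blocks. [cite: LinPryadko2024, §II.B `k = n − rank H_X − rank H_Z` (arXiv:2306.16400 chunk p0005 L28–31)] -/
theorem rank_HX_add_rank_HZ_le {A B : Matrix ι ι F} (hAB : A * B = B * A) :
    (HX A B).rank + (HZ A B).rank ≤ 2 * Fintype.card ι := by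
  have h1 := rank_HX_add_kS_add_defectX hAB
  have h2 := rank_HZ_add_kS_add_defectZ hAB
  omega

/-- The CSS dimension `k = n − rank H_X − rank H_Z`, `n = 2ℓ`, of the two-block code over a field.
[cite: LinPryadko2024, §II.B `k = n − rank H_X − rank H_Z` (arXiv:2306.16400 chunk p0005 L28–31)] -/
noncomputable def dim (A B : Matrix ι ι F) : ℕ := 2 * Fintype.card ι - (HX A B).rank - (HZ A B).rank

/-- **`k = 2k_S + δ_X + δ_Z`** with the intrinsic defects (additive form).
[cite: LinPryadko2024, §III.A `k = 2k_S + δ_X + δ_Z` (tex label eq:two-block-k; arXiv:2306.16400 chunk p0006 L122–126)] -/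
theorem two_mul_card_eq {A B : Matrix ι ι F} (hAB : A * B = B * A) :
    2 * Fintype.card ι = (HX A B).rank + (HZ A B).rank + (2 * kS A B + defectX A B + defectZ A B) := by
  have h1 := rank_HX_add_kS_add_defectX hAB
  have h2 := rank_HZ_add_kS_add_defectZ hAB
  omega

/-- **`k = 2k_S + δ_X + δ_Z`** with the intrinsic defects.
[cite: LinPryadko2024, §III.A `k = 2k_S + δ_X + δ_Z` (tex label eq:two-block-k; arXiv:2306.16400 chunk p0006 L122–126)] -/
theorem dim_eq {A B : Matrix ι ι F} (hAB : A * B = B * A) :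
    dim A B = 2 * kS A B + defectX A B + defectZ A B := by
  have := two_mul_card_eq hAB
  unfold dim
  omega

/-- The tree's CSS dimension of the abelian two-block code `AbelianTwoBlock.css a b` over `𝔽₂` IS
`2k_S + δ_X + δ_Z` (any finite abelian group, any `a, b`; no semisimplicity hypothesis).
[cite: LinPryadko2024, §III.A `k = 2k_S + δ_X + δ_Z` (tex label eq:two-block-k; arXiv:2306.16400 chunk p0006 L122–126)] -/
theorem css_k_eq_abelian {G : Type*} [AddCommGroup G] [Fintype G] [DecidableEq G] (a b : G → ZMod 2) :
    (AbelianTwoBlock.css a b).k =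
      2 * kS (circulant a) (circulant b) + defectX (circulant a) (circulant b)
        + defectZ (circulant a) (circulant b) := by
  rw [CSSCode.k_eq, AbelianTwoBlock.css_HX, AbelianTwoBlock.css_HZ, ← HX_circulant, ← HZ_circulant,
    Fintype.card_sum, ← two_mul, ← dim_eq (circulant_mul_comm a b)]
  rfl

/-- The tree's CSS dimension of the 2BGA code `TwoBlockGA.css a b = LP[a,b]` over `𝔽₂` and an
ARBITRARY finite group IS `2k_S + δ_X + δ_Z` with `A = L(a)`, `B = R(b)`.
[cite: LinPryadko2024, §III.A `k = 2k_S + δ_X + δ_Z` (tex label eq:two-block-k; arXiv:2306.16400 chunk p0006 L122–126); §IV.A (chunk p0009 L47–50)] -/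
theorem css_k_eq_ga {G : Type*} [Group G] [Fintype G] [DecidableEq G] (a b : G → ZMod 2) :
    (TwoBlockGA.css a b).k =
      2 * kS (TwoBlockGA.leftMul a) (TwoBlockGA.rightMul b)
        + defectX (TwoBlockGA.leftMul a) (TwoBlockGA.rightMul b)
        + defectZ (TwoBlockGA.leftMul a) (TwoBlockGA.rightMul b) := by
  rw [CSSCode.k_eq, TwoBlockGA.css_HX, TwoBlockGA.css_HZ, ← HX_leftMul_rightMul,
    ← HZ_leftMul_rightMul, Fintype.card_sum, ← two_mul,
    ← dim_eq (TwoBlockGA.leftMul_mul_rightMul_comm a b)]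
  rfl

end Intrinsic

/-! ### The printed idempotents `E_A`, `F_A` and what they do compute -/

section Idempotents

variable {F : Type*} [Field F] {ι : Type*} [Fintype ι]

/-- `E_A`: "`E_A² = E_A` … of the same rank as `A`, such that `E_A A = A`".
[cite: LinPryadko2024, §III.A `E_A² = E_A, F_A² = F_A, E_A A = A F_A = A`, "of the same rank as A" (tex label eq:idempotent-EA-FA; arXiv:2306.16400 chunk p0006 L33–40)] -/
structure IsLeftIdem (E A : Matrix ι ι F) : Prop where
  /-- `E² = E` -/
  idem : E * E = E
  /-- `E A = A` -/
  mul_eq : E * A = A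
  /-- `rank E = rank A` -/
  rank_eq : E.rank = A.rank

/-- `F_A`: "`F_A² = F_A` … of the same rank as `A`, such that `A F_A = A`".
[cite: LinPryadko2024, §III.A `E_A² = E_A, F_A² = F_A, E_A A = A F_A = A`, "of the same rank as A" (tex label eq:idempotent-EA-FA; arXiv:2306.16400 chunk p0006 L33–40)] -/
structure IsRightIdem (P A : Matrix ι ι F) : Prop where
  /-- `P² = P` -/
  idem : P * P = P
  /-- `A P = A` -/
  mul_eq : A * P = A
  /-- `rank P = rank A` -/
  rank_eq : P.rank = A.rank

/-- `E_A` for `A` transposes to an `F_{Aᵀ}`. [cite: LinPryadko2024, §III.A (tex label eq:idempotent-EA-FA) and App. A.1 "or by a transposition" (arXiv:2306.16400 chunks p0006 L33–40, p0016 L5–7)] -/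
theorem IsLeftIdem.transpose {E A : Matrix ι ι F} (h : IsLeftIdem E A) : IsRightIdem Eᵀ Aᵀ where
  idem := by rw [← Matrix.transpose_mul, h.idem]
  mul_eq := by rw [← Matrix.transpose_mul, h.mul_eq]
  rank_eq := by rw [Matrix.rank_transpose, Matrix.rank_transpose, h.rank_eq]

/-- `F_A` for `A` transposes to an `E_{Aᵀ}`. [cite: LinPryadko2024, §III.A (tex label eq:idempotent-EA-FA) and App. A.1 (arXiv:2306.16400 chunks p0006 L33–40, p0016 L5–7)] -/
theorem IsRightIdem.transpose {P A : Matrix ι ι F} (h : IsRightIdem P A) : IsLeftIdem Pᵀ Aᵀ where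
  idem := by rw [← Matrix.transpose_mul, h.idem]
  mul_eq := by rw [← Matrix.transpose_mul, h.mul_eq]
  rank_eq := by rw [Matrix.rank_transpose, Matrix.rank_transpose, h.rank_eq]

/-- The column space of an admissible `E_A` IS `col A`. [cite: LinPryadko2024, App. A.1 "since DA′ = A′ and their ranks coincide" (arXiv:2306.16400 chunk p0016 L15–17)] -/
theorem IsLeftIdem.col_eq {E A : Matrix ι ι F} (h : IsLeftIdem E A) : col E = col A := by
  symm
  apply Submodule.eq_of_le_of_finrank_eq
  · rw [← h.mul_eq]
    exact col_mul_le_left E A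
  · rw [← rank_eq_finrank_col, ← rank_eq_finrank_col, h.rank_eq]

/-- **Admissible `E_A` exist** ("they can always be constructed"): the projection onto `col A`
along any complement. [cite: LinPryadko2024, §III.A `E_A ≡ U_A D_A U_A⁻¹, F_A ≡ V_A⁻¹ D_A V_A` (tex label eq:EA-FA-matrices; arXiv:2306.16400 chunk p0006 L42–52)] -/
theorem exists_isLeftIdem [DecidableEq ι] (A : Matrix ι ι F) : ∃ E, IsLeftIdem E A := by
  obtain ⟨q, hq⟩ := Submodule.exists_isCompl (col A)
  set P : (ι → F) →ₗ[F] (ι → F) := (col A).projection q hq with hP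
  refine ⟨LinearMap.toMatrix' P, ?_, ?_, ?_⟩
  · rw [← LinearMap.toMatrix'_comp]
    congr 1
    exact (Submodule.isIdempotentElem_projection hq).eq
  · have hA : A = LinearMap.toMatrix' (Matrix.toLin' A) := (LinearMap.toMatrix'_toLin' A).symm
    conv_lhs => rw [hA]
    rw [← LinearMap.toMatrix'_comp]
    conv_rhs => rw [hA]
    congr 1
    apply LinearMap.ext
    intro v
    rw [LinearMap.comp_apply]
    exact Submodule.projection_apply_of_mem_left hq ⟨v, rfl⟩
  · rw [rank_eq_finrank_col, rank_eq_finrank_col, col]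
    have : (LinearMap.toMatrix' P).mulVecLin = P := by
      rw [← Matrix.toLin'_apply', Matrix.toLin'_toMatrix']
    rw [this, Submodule.range_projection]

/-- **Admissible `F_A` exist.** [cite: LinPryadko2024, §III.A `E_A ≡ U_A D_A U_A⁻¹, F_A ≡ V_A⁻¹ D_A V_A` (tex label eq:EA-FA-matrices; arXiv:2306.16400 chunk p0006 L42–52)] -/
theorem exists_isRightIdem [DecidableEq ι] (A : Matrix ι ι F) : ∃ P, IsRightIdem P A := by
  obtain ⟨E, hE⟩ := exists_isLeftIdem Aᵀ
  exact ⟨Eᵀ, by simpa using hE.transpose⟩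

/-- `dim(col A ∩ col B) ≤ rank(E_A B)` for EVERY admissible `E_A` (`E_A` fixes `col A` pointwise, so
`col A ∩ col B ⊆ col(E_A B)`): the intrinsic defect is the least printed one.
[cite: LinPryadko2024, §III.A (tex label eq:rank-defect) and "independent of the choice of idempotents" (arXiv:2306.16400 chunk p0006 L84–98), corrected] -/
theorem finrank_inf_le_rank_idem_mul {E A : Matrix ι ι F} (h : IsLeftIdem E A) (B : Matrix ι ι F) :
    finrank F ↥(col A ⊓ col B) ≤ (E * B).rank := by
  rw [rank_eq_finrank_col]
  apply Submodule.finrank_mono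
  rintro v ⟨hvA, hvB⟩
  obtain ⟨w, rfl⟩ := hvB
  have hvE : B.mulVecLin w ∈ col E := h.col_eq ▸ hvA
  refine ⟨w, ?_⟩
  rw [Matrix.mulVecLin_apply, ← Matrix.mulVec_mulVec]
  exact mulVec_eq_self_of_mem_col h.idem hvE

/-- "`rank E_A B ≥ rank E_A B A = rank AB = p⋆`": `p⋆ ≤ rank(E_A B)` for every admissible `E_A`.
[cite: LinPryadko2024, §III.A (arXiv:2306.16400 chunk p0006 L81)] -/
theorem rank_mul_le_rank_idem_mul {E A B : Matrix ι ι F} (h : IsLeftIdem E A) (hAB : A * B = B * A) :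
    (A * B).rank ≤ (E * B).rank :=
  (rank_mul_le_finrank_inf hAB).trans (finrank_inf_le_rank_idem_mul h B)

/-- The second equality of (RX) holds as an INEQUALITY for every admissible `E_A`:
`rank A + rank B ≤ rank H_X + rank(E_A B)` (equality iff `rank(E_A B) = dim(col A ∩ col B)`).
[cite: LinPryadko2024, §III.A formula `rank H_X = rank A + rank B − rank(E_A B)` (tex label eq:rankHx; arXiv:2306.16400 chunk p0006 L60–66), corrected] -/
theorem rank_add_rank_le_rank_HX_add {E A : Matrix ι ι F} (h : IsLeftIdem E A) (B : Matrix ι ι F) :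
    A.rank + B.rank ≤ (HX A B).rank + (E * B).rank := by
  have h1 := rank_HX_add_finrank_inf A B
  have h2 := finrank_inf_le_rank_idem_mul h B
  omega

/-- **The first equality of (RX), as printed, for every admissible `E_A`:**
`rank H_X = rank A + rank (I − E_A)B`. [cite: LinPryadko2024, §III.A `rank H_X = rank(A) + rank (I−E_A)B` (tex label eq:rankHx, first line; arXiv:2306.16400 chunk p0006 L54–65); WangLinPryadko2023, §III eq. (rankHx) (arXiv:2305.06890 chunk p0005 L35–47)] -/
theorem rank_HX_eq_of_isLeftIdem [DecidableEq ι] {E A : Matrix ι ι F} (h : IsLeftIdem E A) (B : Matrix ι ι F) :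
    (HX A B).rank = A.rank + ((1 - E) * B).rank := by
  have hsup : col A ⊔ col B = col A ⊔ col ((1 - E) * B) := by
    apply le_antisymm
    · refine sup_le le_sup_left ?_
      rintro _ ⟨w, rfl⟩
      have hsplit : B.mulVecLin w = E *ᵥ (B *ᵥ w) + ((1 - E) * B) *ᵥ w := by
        rw [Matrix.mulVecLin_apply, ← Matrix.mulVec_mulVec, Matrix.sub_mulVec, Matrix.one_mulVec,
          add_sub_cancel]
      rw [hsplit]
      refine Submodule.add_mem_sup ?_ ⟨w, rfl⟩
      rw [← h.col_eq]
      exact ⟨B *ᵥ w, by rw [Matrix.mulVecLin_apply]⟩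
    · refine sup_le le_sup_left ?_
      rintro _ ⟨w, rfl⟩
      have hsplit : ((1 - E) * B).mulVecLin w = B *ᵥ w - E *ᵥ (B *ᵥ w) := by
        rw [Matrix.mulVecLin_apply, ← Matrix.mulVec_mulVec, Matrix.sub_mulVec, Matrix.one_mulVec]
      rw [hsplit]
      refine Submodule.sub_mem _ (Submodule.mem_sup_right ⟨w, rfl⟩) (Submodule.mem_sup_left ?_)
      rw [← h.col_eq]
      exact ⟨B *ᵥ w, by rw [Matrix.mulVecLin_apply]⟩
  have hinf : col A ⊓ col ((1 - E) * B) = ⊥ := by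
    rw [← h.col_eq, eq_bot_iff, ← col_inf_ker_eq_bot h.idem]
    exact inf_le_inf_left _ ((col_mul_le_left _ _).trans (col_one_sub_eq_ker h.idem).le)
  have h1 := Submodule.finrank_sup_add_finrank_inf_eq (col A) (col ((1 - E) * B))
  rw [hinf, finrank_bot, add_zero, ← hsup, ← col_fromCols] at h1
  rw [HX, rank_eq_finrank_col, rank_eq_finrank_col, rank_eq_finrank_col, h1]

/-- **The first equality of (RZ), as printed, for every admissible `F_A`:**
`rank H_Z = rank A + rank B(I − F_A)`. [cite: LinPryadko2024, §III.A `rank H_Z` formula (tex label eq:rankHz; arXiv:2306.16400 chunk p0006 L72–77); WangLinPryadko2023, §III `rank H_Z = rank A + rank B(I − F_A)` (arXiv:2305.06890 chunk p0005 L49–53)] -/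
theorem rank_HZ_eq_of_isRightIdem [DecidableEq ι] {P A : Matrix ι ι F} (h : IsRightIdem P A) (B : Matrix ι ι F) :
    (HZ A B).rank = A.rank + (B * (1 - P)).rank := by
  have h1 := rank_HX_eq_of_isLeftIdem h.transpose Bᵀ
  rw [HX, ← Matrix.rank_transpose (fromCols Aᵀ Bᵀ), transpose_fromCols, transpose_transpose,
    transpose_transpose] at h1
  have h2 : ((1 - Pᵀ) * Bᵀ).rank = (B * (1 - P)).rank := by
    rw [← Matrix.rank_transpose (B * (1 - P)), Matrix.transpose_mul, Matrix.transpose_sub,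
      Matrix.transpose_one]
  rw [Matrix.rank_transpose] at h1
  -- `rank H_Z = rank (fromRows B A)ᵀ... ` : compare column spaces
  have h3 : (HZ A B).rank = (fromRows A B).rank := by
    rw [HZ, ← Matrix.rank_transpose, transpose_fromCols, transpose_transpose, transpose_neg,
      transpose_transpose]
    -- rank (fromRows B (-A)) = rank (fromRows A B): same kernel
    unfold Matrix.rank
    have hk : LinearMap.ker (fromRows B (-A)).mulVecLin = LinearMap.ker (fromRows A B).mulVecLin := by
      ext v
      simp only [LinearMap.mem_ker, Matrix.mulVecLin_apply, Matrix.fromRows_mulVec,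
        Matrix.neg_mulVec]
      constructor
      · intro hv
        have h₁ := congr_fun hv
        funext i
        rcases i with i | i
        · have := h₁ (Sum.inr i); simp at this; simpa using this
        · have := h₁ (Sum.inl i); simpa using this
      · intro hv
        have h₁ := congr_fun hv
        funext i
        rcases i with i | i
        · have := h₁ (Sum.inr i); simpa using this
        · have := h₁ (Sum.inl i); simp at this; simpa using this
    have e1 := LinearMap.finrank_range_add_finrank_ker (fromRows B (-A)).mulVecLin
    have e2 := LinearMap.finrank_range_add_finrank_ker (fromRows A B).mulVecLin
    rw [hk] at e1
    omega
  rw [h3, h1, h2]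

/-- **Statement 1 (as printed, for the chosen idempotent): "If `E_A` commutes with `B`, then
`δ_X = 0`"** — `rank(E_A B) = rank(AB)`. [cite: LinPryadko2024, §III.A Statement 1 (arXiv:2306.16400 chunk p0006 L134–137); proof App. A.1 (chunk p0016 L3–22)] -/
theorem rank_idem_mul_eq_rank_mul_of_commute {E A B : Matrix ι ι F} (h : IsLeftIdem E A)
    (hAB : A * B = B * A) (hEB : E * B = B * E) : (E * B).rank = (A * B).rank := by
  apply le_antisymm _ (rank_mul_le_rank_idem_mul h hAB)
  -- `col(E B) = col(B E) = B(col E) = B(col A) = col(BA) = col(AB)`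
  rw [rank_eq_finrank_col, rank_eq_finrank_col, hEB, col_mul_eq_map, h.col_eq, ← col_mul_eq_map,
    ← hAB]

/-- Statement 1, intrinsic consequence: `E_A B = B E_A ⇒ dim(col A ∩ col B) = rank(AB)`, i.e. the
intrinsic `δ_X = 0`. [cite: LinPryadko2024, §III.A Statement 1 (arXiv:2306.16400 chunk p0006 L134–137)] -/
theorem defectX_eq_zero_of_commute {E A B : Matrix ι ι F} (h : IsLeftIdem E A)
    (hAB : A * B = B * A) (hEB : E * B = B * E) : defectX A B = 0 := by
  have h1 := finrank_inf_le_rank_idem_mul h B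
  rw [rank_idem_mul_eq_rank_mul_of_commute h hAB hEB] at h1
  unfold defectX
  omega

/-- Statement 1 ⇒ `rank H_X = rank A + rank B − rank(AB)` (additively).
[cite: LinPryadko2024, §III.A Statement 1 with the `rank H_X` formula (arXiv:2306.16400 chunk p0006 L60–66, L134–137); WangLinPryadko2023, §III Statement 1 (arXiv:2305.06890 chunk p0005 L55–67)] -/
theorem rank_HX_add_rank_mul_of_commute {E A B : Matrix ι ι F} (h : IsLeftIdem E A)
    (hAB : A * B = B * A) (hEB : E * B = B * E) : (HX A B).rank + (A * B).rank = A.rank + B.rank := by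
  have h1 := rank_HX_add_finrank_inf A B
  have h2 := defectX_add hAB
  rw [defectX_eq_zero_of_commute h hAB hEB, zero_add] at h2
  omega

/-- **Statement 1, `Z`-clause: "if `F_A` commutes with `B`, then `δ_Z = 0`"** —
`rank(B F_A) = rank(AB)`. [cite: LinPryadko2024, §III.A Statement 1 (arXiv:2306.16400 chunk p0006 L134–137); proof App. A.1 (chunk p0016 L3–7)] -/
theorem rank_mul_idem_eq_rank_mul_of_commute {P A B : Matrix ι ι F} (h : IsRightIdem P A)
    (hAB : A * B = B * A) (hPB : P * B = B * P) : (B * P).rank = (A * B).rank := by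
  have hT : Aᵀ * Bᵀ = Bᵀ * Aᵀ := by rw [← Matrix.transpose_mul, ← Matrix.transpose_mul, hAB]
  have hPT : Pᵀ * Bᵀ = Bᵀ * Pᵀ := by rw [← Matrix.transpose_mul, ← Matrix.transpose_mul, hPB]
  have := rank_idem_mul_eq_rank_mul_of_commute h.transpose hT hPT
  rwa [← Matrix.transpose_mul, ← Matrix.transpose_mul, Matrix.rank_transpose, Matrix.rank_transpose,
    ← hAB] at this

/-- Statement 1, `Z`-clause, intrinsic consequence: the intrinsic `δ_Z = 0`.
[cite: LinPryadko2024, §III.A Statement 1 (arXiv:2306.16400 chunk p0006 L134–137)] -/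
theorem defectZ_eq_zero_of_commute {P A B : Matrix ι ι F} (h : IsRightIdem P A)
    (hAB : A * B = B * A) (hPB : P * B = B * P) : defectZ A B = 0 := by
  have hT : Aᵀ * Bᵀ = Bᵀ * Aᵀ := by rw [← Matrix.transpose_mul, ← Matrix.transpose_mul, hAB]
  have hPT : Pᵀ * Bᵀ = Bᵀ * Pᵀ := by rw [← Matrix.transpose_mul, ← Matrix.transpose_mul, hPB]
  have h1 := defectX_eq_zero_of_commute h.transpose hT hPT
  unfold defectX at h1
  unfold defectZ
  rwa [← Matrix.transpose_mul, Matrix.rank_transpose, ← hAB] at h1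

/-- Under both clauses of Statement 1 (`E_A B = B E_A`, `F_A B = B F_A`): `rank H_X = rank H_Z` and
`k = 2k_S` ("exactly twice the dimension of the block-erasure subsystem code").
[cite: LinPryadko2024, §III.A last paragraph (arXiv:2306.16400 chunk p0006 L163–172); WangLinPryadko2023, §III Statement 1 `rank H_X = rank H_Z and k = 2(ℓ − rank H_X)` (arXiv:2305.06890 chunk p0005 L62–67)] -/
theorem dim_eq_two_mul_kS_of_commute {E P A B : Matrix ι ι F} (hE : IsLeftIdem E A)
    (hP : IsRightIdem P A) (hAB : A * B = B * A) (hEB : E * B = B * E) (hPB : P * B = B * P) :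
    (HX A B).rank = (HZ A B).rank ∧ dim A B = 2 * kS A B := by
  have h1 := rank_HX_add_kS_add_defectX hAB
  have h2 := rank_HZ_add_kS_add_defectZ hAB
  have h3 := dim_eq hAB
  rw [defectX_eq_zero_of_commute hE hAB hEB] at h1 h3
  rw [defectZ_eq_zero_of_commute hP hAB hPB] at h2 h3
  exact ⟨by omega, by omega⟩

end Idempotents

/-! ### Statement 2 (simultaneous similarity to the transposes) -/

section StatementTwo

variable {F : Type*} [Field F] {ι : Type*} [Fintype ι] [DecidableEq ι]

/-- `col(M T) = col M` when `T` has a right inverse. [folklore] -/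
private theorem col_mul_eq_of_mul_eq_one {T S : Matrix ι ι F} (hTS : T * S = 1) (M : Matrix ι ι F) :
    col (M * T) = col M := by
  apply le_antisymm (col_mul_le_left M T)
  calc col M = col (M * T * S) := by rw [Matrix.mul_assoc, hTS, Matrix.mul_one]
    _ ≤ col (M * T) := col_mul_le_left _ _

/-- `col(S M T) = S(col M)` for `T` invertible. [folklore] -/
private theorem col_conj_eq_map {S T M : Matrix ι ι F} (hTS : T * S = 1) :
    col (S * M * T) = (col M).map S.mulVecLin := by
  rw [Matrix.mul_assoc, col_mul_eq_map, col_mul_eq_of_mul_eq_one hTS]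

/-- **Statement 2 (intrinsic form).** If `S A S⁻¹ = Aᵀ` and `S B S⁻¹ = Bᵀ` for an invertible `S`
(`T S = 1`), then `dim(row A ∩ row B) = dim(col A ∩ col B)`, hence `δ_X = δ_Z`.
[cite: LinPryadko2024, §III.A Statement 2 with `SAS⁻¹ = Aᵀ, SBS⁻¹ = Bᵀ` (tex label eq:sim-transpose; arXiv:2306.16400 chunk p0006 L142–158); proof App. A.2 (chunk p0016 L24–33)] -/
theorem finrank_inf_transpose_eq_of_simTranspose {S T A B : Matrix ι ι F} (hTS : T * S = 1)
    (hA : S * A * T = Aᵀ) (hB : S * B * T = Bᵀ) :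
    finrank F ↥(col Aᵀ ⊓ col Bᵀ) = finrank F ↥(col A ⊓ col B) := by
  have hinj : Function.Injective S.mulVecLin := by
    rw [← LinearMap.ker_eq_bot, Matrix.ker_mulVecLin_eq_bot_iff]
    intro v hv
    have := congr_arg (T *ᵥ ·) hv
    simpa [Matrix.mulVec_mulVec, hTS] using this
  rw [← hA, ← hB, col_conj_eq_map hTS, col_conj_eq_map hTS, ← Submodule.map_inf _ hinj]
  exact (Submodule.equivMapOfInjective _ hinj _).finrank_eq.symm

/-- **Statement 2: `δ_X = δ_Z`** (intrinsic defects). [cite: LinPryadko2024, §III.A Statement 2 (arXiv:2306.16400 chunk p0006 L154–158)] -/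
theorem defectX_eq_defectZ_of_simTranspose {S T A B : Matrix ι ι F} (hTS : T * S = 1)
    (hA : S * A * T = Aᵀ) (hB : S * B * T = Bᵀ) : defectX A B = defectZ A B := by
  unfold defectX defectZ
  rw [finrank_inf_transpose_eq_of_simTranspose hTS hA hB]

/-- Statement 2 ⇒ `rank H_X = rank H_Z` ("we get `rank H_X = rank H_Z`, and code dimension `k`
even"). [cite: LinPryadko2024, §III.A last paragraph (arXiv:2306.16400 chunk p0006 L163–168)] -/
theorem rank_HX_eq_rank_HZ_of_simTranspose {S T A B : Matrix ι ι F} (hTS : T * S = 1)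
    (hA : S * A * T = Aᵀ) (hB : S * B * T = Bᵀ) : (HX A B).rank = (HZ A B).rank := by
  have h1 := rank_HX_add_finrank_inf A B
  have h2 := rank_HZ_add_finrank_inf A B
  rw [finrank_inf_transpose_eq_of_simTranspose hTS hA hB] at h2
  omega

/-- Statement 2 ⇒ `k = 2(k_S + δ_X)` is even. [cite: LinPryadko2024, §III.A last paragraph (arXiv:2306.16400 chunk p0006 L163–168)] -/
theorem dim_eq_of_simTranspose {S T A B : Matrix ι ι F} (hTS : T * S = 1) (hA : S * A * T = Aᵀ)
    (hB : S * B * T = Bᵀ) (hAB : A * B = B * A) : dim A B = 2 * (kS A B + defectX A B) := by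
  rw [dim_eq hAB, ← defectX_eq_defectZ_of_simTranspose hTS hA hB]
  ring

end StatementTwo

/-! ### Kernel counterexamples to the printed text (over `𝔽₂`, `ℓ = 2`) -/

section Counterexamples

/-- `A = diag(1,0)`. [cite: LinPryadko2024, §III.A (arXiv:2306.16400 chunk p0006 L33–98)] -/
def cexA : Matrix (Fin 2) (Fin 2) (ZMod 2) := !![1, 0; 0, 0]

/-- `B = diag(0,1)`. [cite: LinPryadko2024, §III.A (arXiv:2306.16400 chunk p0006 L33–98)] -/
def cexB : Matrix (Fin 2) (Fin 2) (ZMod 2) := !![0, 0; 0, 1]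

/-- The skew admissible idempotent `E = [[1,1],[0,0]]` for `A` (it is `U_A D_A U_A⁻¹` for the
factorisation `A = U_A D_A V_A` with `U_A = [[1,1],[0,1]]`, `D_A = A`, `V_A = 1`, as in the text).
[cite: LinPryadko2024, §III.A `E_A ≡ U_A D_A U_A⁻¹, F_A ≡ V_A⁻¹ D_A V_A` (tex label eq:EA-FA-matrices; arXiv:2306.16400 chunk p0006 L42–52)] -/
def cexE : Matrix (Fin 2) (Fin 2) (ZMod 2) := !![1, 1; 0, 0]

/-- The orthogonal admissible idempotent `E' = diag(1,0)` for `A`. [cite: LinPryadko2024, §III.A `E_A ≡ U_A D_A U_A⁻¹, F_A ≡ V_A⁻¹ D_A V_A` (tex label eq:EA-FA-matrices; arXiv:2306.16400 chunk p0006 L42–52)] -/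
def cexE' : Matrix (Fin 2) (Fin 2) (ZMod 2) := !![1, 0; 0, 0]

/-- An outer product has rank `≤ 1`. [folklore] -/
private theorem rank_le_one_of_eq_vecMulVec {M : Matrix (Fin 2) (Fin 2) (ZMod 2)} (w v : Fin 2 → ZMod 2)
    (h : M = vecMulVec w v) : M.rank ≤ 1 := by
  rw [h]; exact Matrix.rank_vecMulVec_le w v

/-- A non-zero matrix has rank `≥ 1`. [folklore] -/
private theorem one_le_rank_of_ne_zero {M : Matrix (Fin 2) (Fin 2) (ZMod 2)} (h : M ≠ 0) : 1 ≤ M.rank := by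
  rw [Nat.one_le_iff_ne_zero, Ne, Matrix.rank, Submodule.finrank_eq_zero, LinearMap.range_eq_bot]
  intro h'
  apply h
  have : Matrix.toLin' M = 0 := by rw [Matrix.toLin'_apply']; exact h'
  simpa using this

/-- A non-zero outer product has rank `1`. [folklore] -/
private theorem rank_eq_one {M : Matrix (Fin 2) (Fin 2) (ZMod 2)} (w v : Fin 2 → ZMod 2)
    (h : M = vecMulVec w v) (h0 : M ≠ 0) : M.rank = 1 :=
  le_antisymm (rank_le_one_of_eq_vecMulVec w v h) (one_le_rank_of_ne_zero h0)

/-- The data of the first counterexample: `AB = BA`, both `E` and `E'` are admissible `E_A`,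
`rank A = rank B = 1`, `rank(AB) = 0`, `rank(E B) = 1`, `rank(E' B) = 0`, `rank((1−E)B) = 1`,
`rank H_X = 2`. [cite: LinPryadko2024, §III.A (arXiv:2306.16400 chunk p0006 L33–98)] -/
theorem cex_data :
    cexA * cexB = cexB * cexA ∧ IsLeftIdem cexE cexA ∧ IsLeftIdem cexE' cexA ∧
    cexA.rank = 1 ∧ cexB.rank = 1 ∧ (cexA * cexB).rank = 0 ∧ (cexE * cexB).rank = 1 ∧
    (cexE' * cexB).rank = 0 ∧ ((1 - cexE) * cexB).rank = 1 ∧ (HX cexA cexB).rank = 2 := by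
  have hA : cexA.rank = 1 :=
    rank_eq_one ![1, 0] ![1, 0] (by decide) (by decide)
  have hB : cexB.rank = 1 :=
    rank_eq_one ![0, 1] ![0, 1] (by decide) (by decide)
  have hE : cexE.rank = 1 :=
    rank_eq_one ![1, 0] ![1, 1] (by decide) (by decide)
  have hAB : (cexA * cexB).rank = 0 := by
    rw [show cexA * cexB = 0 by decide, Matrix.rank_zero]
  have hEB : (cexE * cexB).rank = 1 :=
    rank_eq_one ![1, 0] ![0, 1] (by decide) (by decide)
  have hE'B : (cexE' * cexB).rank = 0 := by
    rw [show cexE' * cexB = 0 by decide, Matrix.rank_zero]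
  have hIEB : ((1 - cexE) * cexB).rank = 1 :=
    rank_eq_one ![1, 1] ![0, 1] (by decide) (by decide)
  have hHX : (HX cexA cexB).rank = 2 := by
    have h1 := rank_HX_eq_of_isLeftIdem (⟨by decide, by decide, hE.trans hA.symm⟩ : IsLeftIdem cexE cexA)
      cexB
    rw [h1, hA, hIEB]
  exact ⟨by decide, ⟨by decide, by decide, hE.trans hA.symm⟩, ⟨by decide, by decide, rfl⟩, hA, hB,
    hAB, hEB, hE'B, hIEB, hHX⟩

/-- **The printed rank defect depends on the choice of `E_A`** (contrary to "Eqs. (8) and (9)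
guarantee that they are, in fact, independent of the choice of idempotents"): for the commuting pair
`A = diag(1,0)`, `B = diag(0,1)` over `𝔽₂` the admissible idempotents `E`, `E'` give
`rank(E B) − rank(AB) = 1` and `rank(E' B) − rank(AB) = 0`; the printed step
"`rank B = rank(E_A B) + rank (I − E_A)B`" fails for `E` (`1 ≠ 1 + 1`), hence so do the second
equality of (RX) (`rank H_X = 2 ≠ rank A + rank B − rank(E B) = 1`) and `k = 2k_S + δ_X + δ_Z` for this choice
(`k = 0`, `k_S = 0`, printed `δ_X = 1`). [cite: LinPryadko2024, §III.A `rank H_X` formula, "rank B = rank(E_A B) + rank (I−E_A)B", and "independent of the choice of idempotents" (arXiv:2306.16400 chunk p0006 L60–71, L94–98)] -/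
theorem printed_defect_depends_on_choice :
    cexA * cexB = cexB * cexA ∧ IsLeftIdem cexE cexA ∧ IsLeftIdem cexE' cexA ∧
    (cexE * cexB).rank - (cexA * cexB).rank = 1 ∧ (cexE' * cexB).rank - (cexA * cexB).rank = 0 ∧
    cexB.rank ≠ (cexE * cexB).rank + ((1 - cexE) * cexB).rank ∧
    (HX cexA cexB).rank ≠ cexA.rank + cexB.rank - (cexE * cexB).rank ∧
    dim cexA cexB = 0 ∧ kS cexA cexB = 0 := by
  obtain ⟨hc, hE, hE', hA, hB, hAB, hEB, hE'B, hIEB, hHX⟩ := cex_data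
  have hHZ : (HZ cexA cexB).rank = 2 := by
    have := rank_HZ_add_kS_add_defectZ hc
    have h2 := rank_HX_add_kS_add_defectX hc
    have h3 : defectZ cexA cexB = defectX cexA cexB := by
      unfold defectZ defectX
      rw [show cexAᵀ = cexA by decide, show cexBᵀ = cexB by decide]
    simp only [Fintype.card_fin] at this h2
    omega
  refine ⟨hc, hE, hE', by omega, by omega, by omega, by omega, ?_, ?_⟩
  · unfold dim; simp only [Fintype.card_fin]; omega
  · unfold kS; simp only [Fintype.card_fin]; omega

/-- The all-ones `2 × 2` matrix `J = circulant(1 + x)` over `𝔽₂[ℤ₂]` (index group `ZMod 2`).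
[cite: LinPryadko2024, §IV.E `k = 2 deg h(x), h(x) ≡ gcd(a(x), b(x), x^ℓ − 1)` (arXiv:2306.16400 chunk p0011 L1–9)] -/
def onesZ2 : ZMod 2 → ZMod 2 := fun _ => 1

/-- `circulant(1+x)` over `ℤ₂` is the all-ones matrix and squares to zero in characteristic two
(`(1+x)² = 1 + x² = 0 mod x² − 1`). [cite: LinPryadko2024, §IV.E (arXiv:2306.16400 chunk p0011 L1–14)] -/
theorem circulant_onesZ2_mul_self : circulant onesZ2 * circulant onesZ2 = 0 := by decide

/-- The all-ones `2 × 2` matrix over `𝔽₂` has rank `1`. [folklore] -/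
private theorem rank_circulant_onesZ2 : (circulant onesZ2).rank = 1 := by
  apply le_antisymm
  · have : circulant onesZ2 = vecMulVec (fun _ => 1) (fun _ => 1) := by decide
    rw [this]; exact Matrix.rank_vecMulVec_le _ _
  · rw [Nat.one_le_iff_ne_zero, Ne, Matrix.rank, Submodule.finrank_eq_zero, LinearMap.range_eq_bot]
    intro h'
    have : Matrix.toLin' (circulant onesZ2) = 0 := by rw [Matrix.toLin'_apply']; exact h'
    have h2 : circulant onesZ2 = 0 := by simpa using this
    exact absurd (congr_fun (congr_fun h2 0) 0) (by decide)

/-- **The `[[4,2,2]]` code `LP[1+x, 1+x]` over `𝔽₂[ℤ₂]` (a GB / cyclic / abelian 2BGA code):**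
`A = B = J`, `rank A = rank B = 1`, `p⋆ = rank(AB) = 0`, `k_S = 0`, `k = 2`, and the intrinsic
defects are `δ_X = δ_Z = 1`; moreover `rank(E_A B) = 1` and `rank(B F_A) = 1` for EVERY admissible
`E_A`, `F_A` (as `E_A J = J = J F_A`), so the printed defects are `1` for every choice as well.
Consequently the printed sentences "for any cyclic group `G`, `δ_X = δ_Z = 0`" (§IV.D, with
`deg h = deg(1+x) = 1 ≠ k_S = 0`) and Statement 9 "In particular, `δ_X = δ_Z = 0` for any abelian
2BGA code" FAIL for this code (`char 𝔽₂ = 2` divides `|ℤ₂|`: the group algebra is not semisimple).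
[cite: LinPryadko2024, §IV.E "for any cyclic group G, δ_X = δ_Z = 0" (arXiv:2306.16400 chunk p0011 L11–14) and Statement 9 (tex label th:abelian; chunk p0011 L26–35)] -/
theorem fourTwoTwo_defects :
    (AbelianTwoBlock.css onesZ2 onesZ2).k = 2 ∧
    kS (circulant onesZ2) (circulant onesZ2) = 0 ∧
    (circulant onesZ2 * circulant onesZ2).rank = 0 ∧
    defectX (circulant onesZ2) (circulant onesZ2) = 1 ∧
    defectZ (circulant onesZ2) (circulant onesZ2) = 1 ∧
    (∀ E, IsLeftIdem E (circulant onesZ2) → (E * circulant onesZ2).rank = 1) ∧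
    (∀ P, IsRightIdem P (circulant onesZ2) → (circulant onesZ2 * P).rank = 1) := by
  have hJ := rank_circulant_onesZ2
  have hJJ : (circulant onesZ2 * circulant onesZ2).rank = 0 := by
    rw [circulant_onesZ2_mul_self, Matrix.rank_zero]
  have hkS : kS (circulant onesZ2) (circulant onesZ2) = 0 := by
    unfold kS; rw [hJJ, hJ, ZMod.card]
  have hdX : defectX (circulant onesZ2) (circulant onesZ2) = 1 := by
    unfold defectX; rw [inf_idem, ← rank_eq_finrank_col, hJ, hJJ]
  have hdZ : defectZ (circulant onesZ2) (circulant onesZ2) = 1 := by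
    unfold defectZ; rw [inf_idem, ← rank_eq_finrank_col, Matrix.rank_transpose, hJ, hJJ]
  refine ⟨?_, hkS, hJJ, hdX, hdZ, fun E hE => by rw [hE.mul_eq, hJ], fun P hP => by rw [hP.mul_eq, hJ]⟩
  rw [css_k_eq_abelian, hkS, hdX, hdZ]

end Counterexamples

/-! ### Appended (qec-lit-3 g4, second pass): the choice-free dimension formula, attainability of the
intrinsic defect by a good idempotent, and a SEMISIMPLE example of choice-dependence

* `rank_HZ_add_finrank_ker_inf`, `rank_HX_add_finrank_ker_inf_transpose`: `rank H_Z = ℓ − dim(ker A ∩ ker B)`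
  and `rank H_X = ℓ − dim(ker Aᵀ ∩ ker Bᵀ)` for ALL square `A, B` (no commutation needed) — the linear
  algebra of [BravyiEtAl2024, §4, proof of Lemma 1] ("`ker((H^Z)ᵀ) = ker A ∩ ker B`") in general form;
  hence the CHOICE-FREE dimension formula `k = dim(ker A ∩ ker B) + dim(ker Aᵀ ∩ ker Bᵀ)`
  (`dim_eq_finrank_ker_inf_add`) and the defect asymmetry `δ_X − δ_Z = dim(ker Aᵀ ∩ ker Bᵀ) − dim(ker A ∩ ker B)`
  (`defectX_add_finrank_ker_inf`); for an abelian group algebra both kernels have the same dimension, which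
  is the tree's `k = 2·dim(ker A ∩ ker B)` (`AbelianTwoBlock.css_k_eq`).
* `exists_isLeftIdem_rank_mul_eq`: for every `B` there IS an admissible `E_A` with
  `rank(E_A B) = dim(col A ∩ col B)` — the intrinsic defect is the MINIMUM of the printed defects over the
  admissible idempotents (together with `finrank_inf_le_rank_idem_mul`).
* `semisimple_choice_dependence`: choice-dependence is NOT a modular phenomenon — for the SEMISIMPLE
  algebra `𝔽₂[ℤ₃]` and the commuting GB pair `A = circulant(1+x)`, `B = circulant(1+x+x²)` (`AB = 0`,
  `col A ∩ col B = 0`, intrinsic `δ_X = 0`) the skew admissible idempotent `E` (projection onto `col A`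
  along `⟨e₀⟩`) has `rank(E B) = 1 ≠ rank(AB) = 0`, while the idempotent `E' = circulant(x + x²) ∈ 𝔽₂[ℤ₃]`
  (Statement 10's choice `L(e_a)`, which commutes with `B`) has `rank(E' B) = 0`.
-/

section ChoiceFree

variable {F : Type*} [Field F] {ι : Type*} [Fintype ι]

/-- `ker [B ; −A]ᵀ-stack = ker A ∩ ker B`: the kernel of `v ↦ H_Zᵀ v`... stated for the stacked matrix
`fromRows Bᵀᵀ (−Aᵀ)ᵀ`: `ker (H_Z)ᵀ = ker A ⊓ ker B`. [cite: BravyiEtAl2024, §4 proof of Lemma 1 "ker((H^Z)^T) = ker(A) ∩ ker(B)" (arXiv:2308.07915), here for arbitrary square A, B over a field] -/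
theorem ker_HZ_transpose (A B : Matrix ι ι F) :
    LinearMap.ker (HZ A B)ᵀ.mulVecLin = LinearMap.ker A.mulVecLin ⊓ LinearMap.ker B.mulVecLin := by
  ext v
  simp only [HZ, transpose_fromCols, transpose_transpose, transpose_neg, LinearMap.mem_ker,
    Submodule.mem_inf, Matrix.mulVecLin_apply, Matrix.fromRows_mulVec, Matrix.neg_mulVec]
  constructor
  · intro h
    refine ⟨?_, ?_⟩
    · funext i; have := congr_fun h (Sum.inr i); simpa using this
    · funext i; have := congr_fun h (Sum.inl i); simpa using this
  · rintro ⟨hA, hB⟩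
    funext i
    rcases i with i | i
    · simpa using congr_fun hB i
    · simpa using congr_fun hA i

/-- `ker (H_X)ᵀ = ker Aᵀ ⊓ ker Bᵀ`. [cite: BravyiEtAl2024, §4 proof of Lemma 1 (arXiv:2308.07915), X-side analogue for arbitrary square A, B] -/
theorem ker_HX_transpose (A B : Matrix ι ι F) :
    LinearMap.ker (HX A B)ᵀ.mulVecLin = LinearMap.ker Aᵀ.mulVecLin ⊓ LinearMap.ker Bᵀ.mulVecLin := by
  ext v
  simp only [HX, transpose_fromCols, LinearMap.mem_ker, Submodule.mem_inf, Matrix.mulVecLin_apply,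
    Matrix.fromRows_mulVec]
  constructor
  · intro h
    exact ⟨funext fun i => by simpa using congr_fun h (Sum.inl i),
      funext fun i => by simpa using congr_fun h (Sum.inr i)⟩
  · rintro ⟨hA, hB⟩
    funext i
    rcases i with i | i
    · simpa using congr_fun hA i
    · simpa using congr_fun hB i

/-- **`rank H_Z + dim(ker A ∩ ker B) = ℓ`** for all square `A, B` over a field.
[cite: BravyiEtAl2024, §4 proof of Lemma 1 "rk(H^Z) = n/2 − dim(ker A ∩ ker B)" (arXiv:2308.07915), for arbitrary square A, B] -/
theorem rank_HZ_add_finrank_ker_inf (A B : Matrix ι ι F) :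
    (HZ A B).rank + finrank F ↥(LinearMap.ker A.mulVecLin ⊓ LinearMap.ker B.mulVecLin) =
      Fintype.card ι := by
  rw [← ker_HZ_transpose, ← Matrix.rank_transpose (HZ A B), Matrix.rank,
    LinearMap.finrank_range_add_finrank_ker, Module.finrank_fintype_fun_eq_card]

/-- **`rank H_X + dim(ker Aᵀ ∩ ker Bᵀ) = ℓ`** for all square `A, B` over a field.
[cite: BravyiEtAl2024, §4 proof of Lemma 1 (arXiv:2308.07915), X-side analogue for arbitrary square A, B] -/
theorem rank_HX_add_finrank_ker_inf (A B : Matrix ι ι F) :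
    (HX A B).rank + finrank F ↥(LinearMap.ker Aᵀ.mulVecLin ⊓ LinearMap.ker Bᵀ.mulVecLin) =
      Fintype.card ι := by
  rw [← ker_HX_transpose, ← Matrix.rank_transpose (HX A B), Matrix.rank,
    LinearMap.finrank_range_add_finrank_ker, Module.finrank_fintype_fun_eq_card]

/-- **The choice-free dimension formula: `k = dim(ker A ∩ ker B) + dim(ker Aᵀ ∩ ker Bᵀ)`** for the
two-block pair of ANY square `A, B` over a field (no commutation, no semisimplicity).
[cite: BravyiEtAl2024, §4 proof of Lemma 1 "k = n − rk(H^X) − rk(H^Z)", "ker((H^Z)^T) = ker(A) ∩ ker(B)" (arXiv:2308.07915), generalised from bivariate-bicycle to arbitrary square A, B; LinPryadko2024, §II.B `k = n − rank H_X − rank H_Z` (arXiv:2306.16400 chunk p0005 L28–31)] -/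
theorem dim_eq_finrank_ker_inf_add (A B : Matrix ι ι F) :
    dim A B = finrank F ↥(LinearMap.ker A.mulVecLin ⊓ LinearMap.ker B.mulVecLin) +
      finrank F ↥(LinearMap.ker Aᵀ.mulVecLin ⊓ LinearMap.ker Bᵀ.mulVecLin) := by
  have h1 := rank_HZ_add_finrank_ker_inf A B
  have h2 := rank_HX_add_finrank_ker_inf A B
  unfold dim
  omega

/-- The defect asymmetry: `δ_X + dim(ker A ∩ ker B) = δ_Z + dim(ker Aᵀ ∩ ker Bᵀ)`, i.e.
`k = 2·dim(ker A ∩ ker B) + (δ_X − δ_Z)`; in particular `δ_X = δ_Z` iff the two kernels have the same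
dimension (as for abelian group algebras, where `k = 2·dim(ker A ∩ ker B)` is the tree's
`AbelianTwoBlock.css_k_eq`). [cite: LinPryadko2024, §III.A `k = 2k_S + δ_X + δ_Z` (tex label eq:two-block-k; arXiv:2306.16400 chunk p0006 L122–126), combined with BravyiEtAl2024 Lemma 1's kernel count] -/
theorem defectX_add_finrank_ker_inf {A B : Matrix ι ι F} (hAB : A * B = B * A) :
    defectX A B + finrank F ↥(LinearMap.ker A.mulVecLin ⊓ LinearMap.ker B.mulVecLin) =
      defectZ A B + finrank F ↥(LinearMap.ker Aᵀ.mulVecLin ⊓ LinearMap.ker Bᵀ.mulVecLin) := by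
  have h1 := rank_HZ_add_finrank_ker_inf A B
  have h2 := rank_HX_add_finrank_ker_inf A B
  have h3 := rank_HX_add_kS_add_defectX hAB
  have h4 := rank_HZ_add_kS_add_defectZ hAB
  omega

end ChoiceFree

section Attainability

variable {F : Type*} [Field F] {ι : Type*} [Fintype ι] [DecidableEq ι]

/-- The projection onto `col A` along ANY complement `q` is an admissible `E_A`.
[cite: LinPryadko2024, §III.A `E_A ≡ U_A D_A U_A⁻¹` "such matrices are not unique" (arXiv:2306.16400 chunk p0006 L42–52)] -/
theorem isLeftIdem_projection (A : Matrix ι ι F) {q : Submodule F (ι → F)} (hq : IsCompl (col A) q) :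
    IsLeftIdem (LinearMap.toMatrix' ((col A).projection q hq)) A := by
  set P : (ι → F) →ₗ[F] (ι → F) := (col A).projection q hq with hPdef
  have hP : (LinearMap.toMatrix' P).mulVecLin = P := by
    rw [← Matrix.toLin'_apply', Matrix.toLin'_toMatrix']
  refine ⟨?_, ?_, ?_⟩
  · rw [← LinearMap.toMatrix'_comp]
    congr 1
    exact (Submodule.isIdempotentElem_projection hq).eq
  · have hA : A = LinearMap.toMatrix' (Matrix.toLin' A) := (LinearMap.toMatrix'_toLin' A).symm
    have hfix : ∀ v, P (Matrix.toLin' A v) = Matrix.toLin' A v := fun v =>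
      Submodule.projection_apply_of_mem_left hq ⟨v, rfl⟩
    calc LinearMap.toMatrix' P * A
        = LinearMap.toMatrix' P * LinearMap.toMatrix' (Matrix.toLin' A) := by
          rw [LinearMap.toMatrix'_toLin']
      _ = LinearMap.toMatrix' (P.comp (Matrix.toLin' A)) := (LinearMap.toMatrix'_comp _ _).symm
      _ = LinearMap.toMatrix' (Matrix.toLin' A) := by
          congr 1; exact LinearMap.ext hfix
      _ = A := LinearMap.toMatrix'_toLin' A
  · rw [Matrix.rank, Matrix.rank, hP, Submodule.range_projection]

/-- **The intrinsic defect is attained**: for every `A, B` there is an admissible `E_A` with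
`rank(E_A B) = dim(col A ∩ col B)` (take the complement of `col A` to contain a complement of
`col A ∩ col B` inside `col B`); with `finrank_inf_le_rank_idem_mul`, `dim(col A ∩ col B)` is the least
value of the printed `rank(E_A B)` over the admissible idempotents.
[cite: LinPryadko2024, §III.A (tex label eq:rank-defect) and "independent of the choice of idempotents" (arXiv:2306.16400 chunk p0006 L84–98), corrected] -/
theorem exists_isLeftIdem_rank_mul_eq (A B : Matrix ι ι F) :
    ∃ E, IsLeftIdem E A ∧ (E * B).rank = finrank F ↥(col A ⊓ col B) := by
  -- `r` : a complement of `col A ⊓ col B` inside `col B`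
  obtain ⟨r₀, hr₀⟩ := Submodule.exists_isCompl (Submodule.comap (col B).subtype (col A ⊓ col B))
  set r : Submodule F (ι → F) := r₀.map (col B).subtype with hr
  have hrB : r ≤ col B := by
    rw [hr]; rintro _ ⟨x, -, rfl⟩; exact x.2
  have hr_inf : col A ⊓ r = ⊥ := by
    rw [eq_bot_iff]
    rintro x ⟨hxA, hxr⟩
    obtain ⟨y, hy, rfl⟩ := hxr
    have hy' : y ∈ Submodule.comap (col B).subtype (col A ⊓ col B) := ⟨hxA, y.2⟩
    have : y ∈ Submodule.comap (col B).subtype (col A ⊓ col B) ⊓ r₀ := ⟨hy', hy⟩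
    rw [hr₀.inf_eq_bot, Submodule.mem_bot] at this
    simp [this]
  have hr_sup : (col A ⊓ col B) ⊔ r = col B := by
    apply le_antisymm (sup_le inf_le_right hrB)
    intro x hx
    have htop : (⟨x, hx⟩ : ↥(col B)) ∈ (⊤ : Submodule F ↥(col B)) := trivial
    rw [← hr₀.sup_eq_top, Submodule.mem_sup] at htop
    obtain ⟨y, hy, z, hz, hyz⟩ := htop
    have hx' : x = (y : ι → F) + (z : ι → F) := by
      have := congr_arg Subtype.val hyz; simpa using this.symm
    rw [hx']
    exact Submodule.add_mem_sup hy ⟨z, hz, rfl⟩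
  -- `s` : a complement of `col A ⊔ r`; `q := r ⊔ s` is a complement of `col A` containing `r`
  obtain ⟨s, hs⟩ := Submodule.exists_isCompl (col A ⊔ r)
  have hq : IsCompl (col A) (r ⊔ s) := by
    refine IsCompl.of_eq ?_ ?_
    · rw [eq_bot_iff]
      rintro x ⟨hxA, hxq⟩
      rw [SetLike.mem_coe, Submodule.mem_sup] at hxq
      obtain ⟨y, hy, z, hz, rfl⟩ := hxq
      have hz' : z ∈ (col A ⊔ r) ⊓ s := by
        refine ⟨?_, hz⟩
        have : y + z - y ∈ col A ⊔ r := Submodule.sub_mem _ (Submodule.mem_sup_left hxA)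
          (Submodule.mem_sup_right hy)
        simpa using this
      rw [hs.inf_eq_bot, Submodule.mem_bot] at hz'
      subst hz'
      have hy' : y ∈ col A ⊓ r := ⟨by simpa using hxA, hy⟩
      rw [hr_inf, Submodule.mem_bot] at hy'
      simp [hy']
    · rw [← sup_assoc, hs.sup_eq_top]
  refine ⟨LinearMap.toMatrix' ((col A).projection (r ⊔ s) hq), isLeftIdem_projection A hq, ?_⟩
  -- `col (E B) = E(col B) = E((col A ⊓ col B) ⊔ r) = col A ⊓ col B`
  set P : (ι → F) →ₗ[F] (ι → F) := (col A).projection (r ⊔ s) hq with hPdef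
  have hP : (LinearMap.toMatrix' P).mulVecLin = P := by
    rw [← Matrix.toLin'_apply', Matrix.toLin'_toMatrix']
  have h1 : Submodule.map P (col A ⊓ col B) = col A ⊓ col B := by
    ext x
    constructor
    · rintro ⟨y, hy, rfl⟩
      rw [hPdef, Submodule.projection_apply_of_mem_left hq hy.1]
      exact hy
    · intro hx
      exact ⟨x, hx, Submodule.projection_apply_of_mem_left hq hx.1⟩
  have h2 : Submodule.map P r = ⊥ := by
    rw [← LinearMap.le_ker_iff_map, hPdef, Submodule.ker_projection]
    exact le_sup_left
  have hcol : LinearMap.range (LinearMap.toMatrix' P * B).mulVecLin = col A ⊓ col B := by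
    rw [Matrix.mulVecLin_mul, LinearMap.range_comp, hP]
    calc Submodule.map P (LinearMap.range B.mulVecLin)
        = Submodule.map P ((col A ⊓ col B) ⊔ r) := by rw [hr_sup]
      _ = col A ⊓ col B := by rw [Submodule.map_sup, h1, h2, sup_bot_eq]
  rw [Matrix.rank, hcol]

end Attainability

section SemisimpleExample

/-- An outer product has rank `≤ 1` (any index type). [folklore] -/
private theorem rank_le_one_of_eq_vecMulVec' {m : Type*} [Fintype m] [DecidableEq m]
    {M : Matrix m m (ZMod 2)} (w v : m → ZMod 2) (h : M = vecMulVec w v) : M.rank ≤ 1 := by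
  rw [h]; exact Matrix.rank_vecMulVec_le w v

/-- A non-zero matrix has rank `≥ 1` (any index type). [folklore] -/
private theorem one_le_rank_of_ne_zero' {m : Type*} [Fintype m] [DecidableEq m]
    {M : Matrix m m (ZMod 2)} (h : M ≠ 0) : 1 ≤ M.rank := by
  rw [Nat.one_le_iff_ne_zero, Ne, Matrix.rank, Submodule.finrank_eq_zero, LinearMap.range_eq_bot]
  intro h'
  apply h
  have : Matrix.toLin' M = 0 := by rw [Matrix.toLin'_apply']; exact h'
  simpa using this

/-- Mutual left factorisations give equal ranks: `E = A X`, `A = E Y` ⇒ `rank E = rank A`. [folklore] -/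
private theorem rank_eq_of_mutual_factor {m : Type*} [Fintype m] {F : Type*} [Field F]
    {E A X Y : Matrix m m F} (h1 : E = A * X) (h2 : A = E * Y) : E.rank = A.rank :=
  le_antisymm (h1 ▸ Matrix.rank_mul_le_left A X) (h2 ▸ Matrix.rank_mul_le_left E Y)

/-- **Choice-dependence in a SEMISIMPLE group algebra (`𝔽₂[ℤ₃]`, `2 ∤ 3`).** For the commuting GB pair
`A = circulant(1+x) = circulant ![1,1,0]`, `B = circulant(1+x+x²) = circulant ![1,1,1]` over `ℤ₃`:
`AB = 0` (`p⋆ = 0`), `rank B = 1`; the algebra idempotent `E' = circulant(x+x²) = circulant ![0,1,1]`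
(`(x+x²)² = x+x²`, `(x+x²)(1+x) = 1+x`: Statement 10's `L(e_a)`) is an admissible `E_A`, commutes with
`B` and has `rank(E' B) = 0`, whence the INTRINSIC defect vanishes (`dim(col A ∩ col B) = 0`, `δ_X = 0`,
as Statement 10 predicts); but the skew matrix `E = [[0,1,1],[0,1,0],[0,0,1]]` (the projection onto
`col A` = even-weight vectors along `⟨e₀⟩`; not a circulant) is ALSO an admissible `E_A`, with
`E B ≠ B E` and `rank(E B) = 1`, i.e. printed `δ_X = 1`. So the printed defect is choice-dependent even
when `F[G]` is semisimple — semisimplicity supplies a good choice, not independence of the choice.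
[cite: LinPryadko2024, §III.A "independent of the choice of idempotents" (arXiv:2306.16400 chunk p0006 L94–98) and §IV.E Statement 10 "there exist idempotent elements e_a … E_A = L(e_a) … guaranteed to commute with B" (chunk p0011 L37–45)] -/
theorem semisimple_choice_dependence :
    circulant (![1, 1, 0] : ZMod 3 → ZMod 2) * circulant (![1, 1, 1] : ZMod 3 → ZMod 2) = 0 ∧
    circulant (![1, 1, 0] : ZMod 3 → ZMod 2) * circulant (![1, 1, 1] : ZMod 3 → ZMod 2) =
      circulant (![1, 1, 1] : ZMod 3 → ZMod 2) * circulant (![1, 1, 0] : ZMod 3 → ZMod 2) ∧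
    (circulant (![1, 1, 1] : ZMod 3 → ZMod 2)).rank = 1 ∧
    IsLeftIdem (circulant (![0, 1, 1] : ZMod 3 → ZMod 2)) (circulant (![1, 1, 0] : ZMod 3 → ZMod 2)) ∧
    circulant (![0, 1, 1] : ZMod 3 → ZMod 2) * circulant (![1, 1, 1] : ZMod 3 → ZMod 2) =
      circulant (![1, 1, 1] : ZMod 3 → ZMod 2) * circulant (![0, 1, 1] : ZMod 3 → ZMod 2) ∧
    (circulant (![0, 1, 1] : ZMod 3 → ZMod 2) * circulant (![1, 1, 1] : ZMod 3 → ZMod 2)).rank = 0 ∧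
    finrank (ZMod 2) ↥(col (circulant (![1, 1, 0] : ZMod 3 → ZMod 2)) ⊓
      col (circulant (![1, 1, 1] : ZMod 3 → ZMod 2))) = 0 ∧
    defectX (circulant (![1, 1, 0] : ZMod 3 → ZMod 2)) (circulant (![1, 1, 1] : ZMod 3 → ZMod 2)) = 0 ∧
    IsLeftIdem (!![0, 1, 1; 0, 1, 0; 0, 0, 1] : Matrix (ZMod 3) (ZMod 3) (ZMod 2))
      (circulant (![1, 1, 0] : ZMod 3 → ZMod 2)) ∧
    (!![0, 1, 1; 0, 1, 0; 0, 0, 1] : Matrix (ZMod 3) (ZMod 3) (ZMod 2)) * circulant ![1, 1, 1] ≠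
      circulant (![1, 1, 1] : ZMod 3 → ZMod 2) * !![0, 1, 1; 0, 1, 0; 0, 0, 1] ∧
    ((!![0, 1, 1; 0, 1, 0; 0, 0, 1] : Matrix (ZMod 3) (ZMod 3) (ZMod 2)) *
      circulant (![1, 1, 1] : ZMod 3 → ZMod 2)).rank = 1 := by
  have hAB : circulant (![1, 1, 0] : ZMod 3 → ZMod 2) * circulant (![1, 1, 1] : ZMod 3 → ZMod 2) = 0 := by
    decide
  have hB : (circulant (![1, 1, 1] : ZMod 3 → ZMod 2)).rank = 1 :=
    le_antisymm (rank_le_one_of_eq_vecMulVec' (fun _ => 1) (fun _ => 1) (by decide))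
      (one_le_rank_of_ne_zero' (by decide))
  have hE' : IsLeftIdem (circulant (![0, 1, 1] : ZMod 3 → ZMod 2))
      (circulant (![1, 1, 0] : ZMod 3 → ZMod 2)) :=
    ⟨by decide, by decide,
      rank_eq_of_mutual_factor (X := circulant (![0, 1, 0] : ZMod 3 → ZMod 2))
        (Y := circulant (![1, 1, 0] : ZMod 3 → ZMod 2)) (by decide) (by decide)⟩
  have hE'B : (circulant (![0, 1, 1] : ZMod 3 → ZMod 2) *
      circulant (![1, 1, 1] : ZMod 3 → ZMod 2)).rank = 0 := by
    rw [show circulant (![0, 1, 1] : ZMod 3 → ZMod 2) * circulant (![1, 1, 1] : ZMod 3 → ZMod 2) = 0 by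
      decide, Matrix.rank_zero]
  have hinf : finrank (ZMod 2) ↥(col (circulant (![1, 1, 0] : ZMod 3 → ZMod 2)) ⊓
      col (circulant (![1, 1, 1] : ZMod 3 → ZMod 2))) = 0 := by
    have := finrank_inf_le_rank_idem_mul hE' (circulant (![1, 1, 1] : ZMod 3 → ZMod 2))
    omega
  have hE : IsLeftIdem (!![0, 1, 1; 0, 1, 0; 0, 0, 1] : Matrix (ZMod 3) (ZMod 3) (ZMod 2))
      (circulant (![1, 1, 0] : ZMod 3 → ZMod 2)) :=
    ⟨by decide, by decide,
      rank_eq_of_mutual_factor (X := (!![0, 1, 0; 0, 0, 0; 0, 0, 1] : Matrix (ZMod 3) (ZMod 3) (ZMod 2)))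
        (Y := circulant (![1, 1, 0] : ZMod 3 → ZMod 2)) (by decide) (by decide)⟩
  have hEB : ((!![0, 1, 1; 0, 1, 0; 0, 0, 1] : Matrix (ZMod 3) (ZMod 3) (ZMod 2)) *
      circulant (![1, 1, 1] : ZMod 3 → ZMod 2)).rank = 1 :=
    le_antisymm (rank_le_one_of_eq_vecMulVec' ![0, 1, 1] (fun _ => 1) (by decide))
      (one_le_rank_of_ne_zero' (by decide))
  refine ⟨hAB, by decide, hB, hE', by decide, hE'B, hinf, ?_, hE, by decide, hEB⟩
  unfold defectX
  rw [hinf, hAB, Matrix.rank_zero]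

end SemisimpleExample

end TwoBlock

end Literature.InformationTheory.QuantumCodes
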